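import Literature.AnabelianGeometry.SemiGraphs.TemperedSpecialFibreTowerVertexAction
import HarnessLib

/-!
# Vertex actions are INTERTWINED along chart-compatible, locally open morphisms of semi-graphs of
# anabelioids ([SemiAnbd] Thm. 3.7 (ii)/(iv), Ex. 3.10, Cor. 3.11 «compatible»; proof-only)

Mochizuki, *Semi-graphs of anabelioids*, Publ. RIMS **42** (2006), §3: Thm. 3.7 (ii) p. 40 («if `H₁`, `H₂` are
verticial subgroups … that arise from distinct parametrization data, then `H₁ ∩ H₂` has infinite index in
`H₁`»), Thm. 3.7 (iv) p. 41 («the maximal compact subgroups … are precisely the verticial subgroups»), Prop. 3.6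
(iv) p. 39, Ex. 3.10 p. 44 l. 12–17 («semi-graphs of anabelioids `𝒢_i`, `𝒢^c_i` on which `Δ_i` acts … natural
morphisms … compatible with the actions») and Cor. 3.11 pp. 45–47 («a compatible isomorphism … functorial with
respect to `γ`»; proof (i): «open subgroups of finite index `Δ'[α] ⊆ Δ[α]`, `Δ'[β] ⊆ Δ[β]` that correspond via
`γ`») [cite: MochizukiSemiAnbd2006, Thm 3.7(ii)(iv) pp.40-41]; [IUTchI] §2, proof of Prop. 2.4 (i) p. 50 (the
action of `Π^tp_X` on the special fibre of `X_J` through `Π^tp_X/J`) [cite: Mochizuki2012, Prop 2.4(i) p.50]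
[claim: Mochizuki2012, status: disputed] (nothing of the IUT series is asserted here).

abc-iut cell, layer L3, seat abc-iut-L3-d2 gen 7, banked row «COR311-VERTEX-EQUIVARIANCE@TOWER (FACT-FREE)»
(L3-lead γ85 (3)/γ87 (3); GO γ94).  PROOF-ONLY (no `def`, no `instance`, no notation, no `Prop` fact).  Inputs BY
NAME: abc-iut-L3-t2's DERIVED tower vertex action and its dictionary (`SpecialFibreTower.actVertex_apply_eq_iff`,
`autOfConj_adm`), Thm. 3.7 (ii) `verticialDistinct_holds`, Thm. 3.7 (i) `exists_isVerticialHom`, Prop. 3.2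
conjugacy (`exists_conj_of_mem_verticialSubgroups`, `conj_mem_verticialSubgroups`), and the Thm. 3.7 (iv)
binder `MaximalCompactIffVerticialAt` at the TARGET only (a theorem at finite targets, abc-iut-L3-t8's
`maximalCompactIffVerticialAt_of_finiteGraph`).  NO Cor. 3.9, NO Cor. 3.11 (F-1721), no origin hypothesis; the
base-level self-map case is abc-iut-L3-d1's `cor311Compatible_conjDelta_vertexMap` (not redone).

WHAT IS PROVED.
* (G) `verticialSubgroups_map_of_intertwines` — chart level, for ANY morphism `F : 𝒢 → 𝒢'` of semi-graphs of
  anabelioids LOCALLY OPEN on vertex groups and ANY homomorphism `φ : π₁^temp(𝒢) → π₁^temp(𝒢')` compatible with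
  `F` on verticial homomorphisms up to conjugation (the shape of `ChartCompatible` / `InducedHomOfMorphism`;
  `φ` need not be injective or surjective, so covering projections `𝒢_i → 𝒢` are covered): if
  `a ∈ End(π₁^temp(𝒢))`, `a' ∈ Aut(π₁^temp(𝒢'))` satisfy `φ ∘ a = a' ∘ φ` and `a` carries some verticial subgroup
  at `v` to one at `w`, then `a'` carries EVERY verticial subgroup at `F v` to one at `F w`.  Proof: `φ` maps
  a verticial subgroup at `u` onto a FINITE-INDEX subgroup of a verticial subgroup at `F u` (local openness,
  `exists_verticial_ge_map_of_compat`); `a'` of a maximal compact subgroup is maximal compact, hence verticial at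
  some `u'` (Thm. 3.7 (iv)); it shares a finite-index subgroup with a verticial subgroup at `F w`, so `u' = F w`
  (Thm. 3.7 (ii)); conjugacy finishes.
* (I2) `SpecialFibreTower.vertexMap_actVertex_of_intertwines` / `_of_descends` — levels `i`, `j` of two
  special-fibre towers over `Δ_X ◁ Γ_X`, `Δ_Y ◁ Γ_Y`: ★ for `g ∈ Δ_X` and a homomorphism `γ : Δ_X → Δ_Y` carrying
  `N^X_i` into `N^Y_j` which `φ` descends along the admissible quotients, `F (g · v) = γ(g) · F v` — VERBATIM the
  VERTEX twin of the edge clause (3) of the binder `hLG` of abc-iut-L3-t11's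
  `TemperedCuspidalAbsolutenessOfProCusps.lean` (Thm. 6.5 (iii) route), for the DERIVED actions, hypothesis =
  chart-compatibility of the level morphism only.

HONEST LIMITS.  Vertices only: open edges (cusps) are invisible to `π₁^temp` (Rmk. 3.9.1), so nothing here
touches the EDGE clause of `hLG` or the F-1704 residual (β′).  The same one-line instantiations of (G) for two
BASE special fibres (`SpecialFibreData.actVertex`, the `G_K`-part) and for a level over the base fibre (the shape
of `PiData.proj_actVertex` as a theorem for chart-level projections) are left to a sequel.  Nothing here asserts
anything for a curve, asserts or refutes abc, or takes a side on [IUTchIII] Cor. 3.12; typed ≠ proved.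
-/

noncomputable section

namespace Literature.AnabelianGeometry.SemiGraphs

open ProfiniteSemiGraph Topology
open scoped Pointwise

universe u

/-! ### Three pieces of topological group theory -/

/-- An open subgroup of a compact topological group has finite index. [folklore] -/
private theorem index_ne_zero_of_isOpen' {G : Type u} [Group G] [TopologicalSpace G] [IsTopologicalGroup G]
    [CompactSpace G] (H : Subgroup G) (hH : IsOpen (H : Set G)) : H.index ≠ 0 := by
  haveI : DiscreteTopology (G ⧸ H) := QuotientGroup.discreteTopology_iff.mpr hH
  haveI : Finite (G ⧸ H) := finite_of_compact_of_discrete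
  exact Subgroup.index_ne_zero_of_finite

/-- A topological-group automorphism carries maximal compact subgroups to maximal compact subgroups. [folklore] -/
private theorem isMaximalCompactSubgroup_map'' {G : Type u} [Group G] [TopologicalSpace G] [IsTopologicalGroup G]
    (e : G ≃ₜ* G) {K : Subgroup G} (hK : IsMaximalCompactSubgroup K) :
    IsMaximalCompactSubgroup (K.map e.toMonoidHom) := by
  refine ⟨?_, fun K' hK' hle => ?_⟩
  · rw [Subgroup.coe_map]; exact hK.1.image e.continuous
  · have hpre : IsCompact ((K'.map e.symm.toMonoidHom : Subgroup G) : Set G) := by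
      rw [Subgroup.coe_map]; exact hK'.image e.symm.continuous
    have hKle : K ≤ K'.map e.symm.toMonoidHom := fun k hk => ⟨e k, hle ⟨k, hk, rfl⟩, e.symm_apply_apply k⟩
    refine le_antisymm (fun y hy => ⟨e.symm y, ?_, e.apply_symm_apply y⟩) hle
    rw [← hK.2 _ hpre hKle]; exact ⟨y, hy, rfl⟩

/-- Images of conjugates: `e(x H x⁻¹) = e(x) e(H) e(x)⁻¹`. [folklore] -/
private theorem map_conj_map'' {G : Type u} [Group G] [TopologicalSpace G] (e : G ≃ₜ* G) (H : Subgroup G)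
    (x : G) : (H.map (MulAut.conj x).toMonoidHom).map e.toMonoidHom =
      (H.map e.toMonoidHom).map (MulAut.conj (e x)).toMonoidHom := by
  rw [Subgroup.map_map, Subgroup.map_map]; congr 1; ext y
  show e (x * y * x⁻¹) = e x * e y * (e x)⁻¹; rw [map_mul, map_mul, map_inv]

/-! ### (G) Chart level: compatible homomorphisms and intertwined automorphisms act compatibly on vertices -/

namespace ProfiniteSemiGraph

variable {𝒢 𝒢' : ProfiniteSemiGraph.{u}} (h𝒢' : 𝒢'.Thm37Hypotheses) (c : TemperedPiChart 𝒢)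
  (c' : TemperedPiChart 𝒢') (F : Hom 𝒢 𝒢')
  (hFo : ∀ v, IsOpen ((F.hV v).toMonoidHom.range : Set (𝒢'.Gv (F.base.vertexMap v))))
  (φ : c.G →* c'.G)
  (hφ : ∀ (v : 𝒢.graph.Vertex) (ψ : 𝒢.Gv v →ₜ* c.G) (ψ' : 𝒢'.Gv (F.base.vertexMap v) →ₜ* c'.G),
    IsVerticialHom c v ψ → IsVerticialHom c' (F.base.vertexMap v) ψ' →
      ∃ g : c'.G, ∀ x, φ (ψ x) = g * ψ' (F.hV v x) * g⁻¹)

include h𝒢' hFo hφ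

/-- **A homomorphism `φ : π₁^temp(𝒢) → π₁^temp(𝒢')` compatible with a morphism `F : 𝒢 → 𝒢'` that is locally
open on vertex groups carries every verticial subgroup at `u` onto a FINITE-INDEX subgroup of a verticial
subgroup at `F u`** (the image of `Π_u → Π_{F u}` is open in the profinite group `Π_{F u}`, hence of finite
index; compatibility up to conjugation, Prop. 3.6 (iv) shape). [cite: MochizukiSemiAnbd2006, Prop 3.6(iv) p.39] -/
theorem exists_verticial_ge_map_of_compat {u : 𝒢.graph.Vertex} {H : Subgroup c.G}
    (hH : H ∈ verticialSubgroups c u) :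
    ∃ K' ∈ verticialSubgroups c' (F.base.vertexMap u), H.map φ ≤ K' ∧ (H.map φ).relIndex K' ≠ 0 := by
  obtain ⟨ψ, hψ, rfl⟩ := hH
  obtain ⟨ψ', hψ'⟩ :=
    exists_isVerticialHom h𝒢'.isQuasiCoherent h𝒢'.isGaloisCountable c' (F.base.vertexMap u)
  obtain ⟨g, hg⟩ := hφ u ψ ψ' hψ hψ'
  -- `θ := γ_g ∘ ψ'`, a verticial homomorphism at `F u` composed with an inner automorphism
  let θ : 𝒢'.Gv (F.base.vertexMap u) →* c'.G := (MulAut.conj g).toMonoidHom.comp ψ'.toMonoidHom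
  have hK' : θ.range ∈ verticialSubgroups c' (F.base.vertexMap u) := by
    rw [show θ.range = ψ'.toMonoidHom.range.map (MulAut.conj g).toMonoidHom by rw [MonoidHom.map_range]]
    exact conj_mem_verticialSubgroups c' ⟨ψ', hψ', rfl⟩ g
  have hmap : ψ.toMonoidHom.range.map φ = ((F.hV u).toMonoidHom.range).map θ := by
    rw [MonoidHom.map_range, MonoidHom.map_range]; congr 1; ext x; exact hg x
  refine ⟨θ.range, hK', ?_, ?_⟩
  · rw [hmap]; exact Subgroup.map_le_range θ _
  · rw [hmap, ← Subgroup.index_comap]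
    intro h0
    have hdvd := Subgroup.index_dvd_of_le (Subgroup.le_comap_map θ (F.hV u).toMonoidHom.range)
    rw [h0] at hdvd
    exact index_ne_zero_of_isOpen' _ (hFo u) (Nat.eq_zero_of_zero_dvd hdvd)

/-- ★ (G) **Intertwined automorphisms act compatibly on vertices**: for `F`, `φ` as above (locally open,
compatible on verticial homomorphisms) and `a ∈ End(π₁^temp(𝒢))`, `a' ∈ Aut(π₁^temp(𝒢'))` with `φ ∘ a = a' ∘ φ`,
if `a` carries some verticial subgroup at `v` to one at `w`, then `a'` carries every verticial subgroup at `F v`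
to one at `F w` (Thm. 3.7 (iv) at `𝒢'`; Thm. 3.7 (ii); Prop. 3.2). [cite: MochizukiSemiAnbd2006, Thm 3.7(ii)(iv) pp.40-41] -/
theorem verticialSubgroups_map_of_intertwines (hiv' : MaximalCompactIffVerticialAt 𝒢') (a : c.G →* c.G)
    (a' : c'.G ≃ₜ* c'.G) (hcomm : ∀ x, φ (a x) = a' (φ x)) {v w : 𝒢.graph.Vertex}
    (hvw : ∃ H ∈ verticialSubgroups c v, H.map a ∈ verticialSubgroups c w) :
    ∀ H' ∈ verticialSubgroups c' (F.base.vertexMap v),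
      H'.map a'.toMonoidHom ∈ verticialSubgroups c' (F.base.vertexMap w) := by
  obtain ⟨H, hH, hHa⟩ := hvw
  obtain ⟨K', hK', hle, hidx⟩ := exists_verticial_ge_map_of_compat h𝒢' c c' F hFo φ hφ hH
  obtain ⟨Kw, hKw, hlew, -⟩ := exists_verticial_ge_map_of_compat h𝒢' c c' F hFo φ hφ hHa
  -- `a' K'` is maximal compact, hence verticial at some vertex `u`
  have hmax : IsMaximalCompactSubgroup K' := ((hiv' h𝒢' c').1 K').2 ⟨_, hK'⟩
  obtain ⟨u, hu⟩ := ((hiv' h𝒢' c').1 _).1 (isMaximalCompactSubgroup_map'' a' hmax)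
  -- the common finite-index subgroup `φ (a H) = a' (φ H)`
  have hL : (H.map a).map φ = (H.map φ).map a'.toMonoidHom := by
    rw [Subgroup.map_map, Subgroup.map_map]; congr 1; ext x; exact hcomm x
  have hinj : Function.Injective a'.toMonoidHom := fun x y h => a'.injective h
  have h1 : ((H.map φ).map a'.toMonoidHom).relIndex (K'.map a'.toMonoidHom) ≠ 0 := by
    rw [Subgroup.relIndex_map_map_of_injective _ _ hinj]; exact hidx
  have hu' : u = F.base.vertexMap w := by
    by_contra hne
    have h0 := (verticialDistinct_holds 𝒢' h𝒢' c').1 u (F.base.vertexMap w) _ _ hu hKw hne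
    have h0' : (Kw ⊓ K'.map a'.toMonoidHom).relIndex (K'.map a'.toMonoidHom) = 0 := by
      rw [Subgroup.inf_relIndex_right]; exact h0
    refine h1 (Subgroup.relIndex_eq_zero_of_le_left (le_inf ?_ (Subgroup.map_mono hle)) h0')
    rw [← hL]; exact hlew
  subst hu'
  intro H' hH'
  obtain ⟨x, rfl⟩ := exists_conj_of_mem_verticialSubgroups c' hK' hH'
  rw [map_conj_map'']
  exact conj_mem_verticialSubgroups c' hu _

omit h𝒢' hFo hφ in
/-- Local triviality on vertex groups (e.g. an isomorphism of semi-graphs of anabelioids) gives local openness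
on vertex groups. [cite: MochizukiSemiAnbd2006, Def 2.2(ii) p.24] -/
theorem isOpen_range_hV_of_isLocallyTrivial {F₁ : Hom 𝒢 𝒢'} (hF : F₁.IsLocallyTrivial)
    (v : 𝒢.graph.Vertex) : IsOpen ((F₁.hV v).toMonoidHom.range : Set (𝒢'.Gv (F₁.base.vertexMap v))) := by
  rw [MonoidHom.range_eq_top.mpr (hF.1 v).2, Subgroup.coe_top]; exact isOpen_univ

end ProfiniteSemiGraph

/-! ### (I2) Two levels of two special-fibre towers: `F (g · v) = γ(g) · F v` -/

namespace SpecialFibreTower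

variable {ΓX : Type u} [Group ΓX] [TopologicalSpace ΓX] [IsTopologicalGroup ΓX] {ΔX : Subgroup ΓX}
  [ΔX.Normal] {ΓY : Type u} [Group ΓY] [TopologicalSpace ΓY] [IsTopologicalGroup ΓY] {ΔY : Subgroup ΓY}
  [ΔY.Normal] (TX : SpecialFibreTower ΔX) (TY : SpecialFibreTower ΔY)
  (hP0X : ∀ i, ((TX.admKer i).map ΔX.subtype).Normal) (hP0Y : ∀ j, ((TY.admKer j).map ΔY.subtype).Normal)
  {i j : ℕ}

/-- **The intertwining DERIVED when `φ` descends a homomorphism of the levels**: if `γN : N^X_i → N^Y_j`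
satisfies `φ ∘ adm_i = adm_j ∘ γN` and intertwines conjugation by `g` with conjugation by `g'`, then
`φ ∘ autOfConj_X g = autOfConj_Y g' ∘ φ` (`autOfConj_adm`). [cite: MochizukiSemiAnbd2006, Ex 3.10 p.45] -/
theorem autOfConj_intertwines_of_descends (φ : (TX.chart i).G →* (TY.chart j).G) (γN : TX.N i →* TY.N j)
    (hφ : ∀ n : TX.N i, φ (TX.adm i n) = TY.adm j (γN n)) {g : ΓX} {g' : ΓY}
    (hγ : ∀ n : TX.N i, γN (TX.conjN i g n) = TY.conjN j g' (γN n)) (x : (TX.chart i).G) :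
    φ (TX.autOfConj hP0X i g x) = TY.autOfConj hP0Y j g' (φ x) := by
  obtain ⟨n, rfl⟩ := TX.adm_surjective i x
  rw [autOfConj_adm, hφ, hφ, autOfConj_adm, hγ]

variable (hivX : MaximalCompactIffVerticialAt (TX.Gc i)) (hivY : MaximalCompactIffVerticialAt (TY.Gc j))
  (F : Hom (TX.Gc i) (TY.Gc j))
  (hFo : ∀ v, IsOpen ((F.hV v).toMonoidHom.range : Set ((TY.Gc j).Gv (F.base.vertexMap v))))
  (φ : (TX.chart i).G →* (TY.chart j).G)
  (hφ : ∀ (v : (TX.Gc i).graph.Vertex) (ψ : (TX.Gc i).Gv v →ₜ* (TX.chart i).G)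
    (ψ' : (TY.Gc j).Gv (F.base.vertexMap v) →ₜ* (TY.chart j).G),
    IsVerticialHom (TX.chart i) v ψ → IsVerticialHom (TY.chart j) (F.base.vertexMap v) ψ' →
      ∃ g : (TY.chart j).G, ∀ x, φ (ψ x) = g * ψ' (F.hV v x) * g⁻¹)

include hFo hφ

/-- ★ (I2) **The derived vertex actions of two tower levels are intertwined along a chart-compatible, locally
open morphism of the level fibres**: `φ ∘ autOfConj_X g = autOfConj_Y g' ∘ φ` implies `F (g · v) = g' · F v`
for abc-iut-L3-t2's `SpecialFibreTower.actVertex` ([IUTchI] p. 50: the action of `Π^tp_X` on `𝔾_J`).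
[cite: MochizukiSemiAnbd2006, Ex 3.10 p.44] -/
theorem vertexMap_actVertex_of_intertwines {g : ΓX} {g' : ΓY}
    (hg : ∀ x, φ (TX.autOfConj hP0X i g x) = TY.autOfConj hP0Y j g' (φ x)) (v : (TX.Gc i).graph.Vertex) :
    F.base.vertexMap (TX.actVertex hP0X i hivX g v) = TY.actVertex hP0Y j hivY g' (F.base.vertexMap v) := by
  symm
  rw [actVertex_apply_eq_iff]
  obtain ⟨H, hH⟩ := TX.verticialSubgroups_nonempty i v
  exact verticialSubgroups_map_of_intertwines (TY.hyp j) (TX.chart i) (TY.chart j) F hFo φ hφ hivY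
    (TX.autOfConj hP0X i g).toMonoidHom (TY.autOfConj hP0Y j g') hg
    ⟨H, hH, (TX.actVertex_apply_eq_iff hP0X i hivX g v _).1 rfl H hH⟩

/-- ★ (I2) **along a homomorphism `γ : Δ_X → Δ_Y` carrying `N^X_i` into `N^Y_j`** (the printed «open subgroups
of finite index `Δ'[α] ⊆ Δ[α]`, `Δ'[β] ⊆ Δ[β]` that correspond via `γ`», Cor. 3.11 proof p. 47 (i)) which `φ`
descends along the admissible quotients: for `g ∈ Δ_X`, `F (g · v) = γ(g) · F v` — VERBATIM the vertex twin of
the edge clause (3) of the Thm. 6.5 (iii) binder `hLG` (`(FI i) ((AX i g) e) = (AY i (γ g)) ((FI i) e)`), for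
the DERIVED vertex actions, hypothesis = chart-compatibility of `F` with such a `φ`.
[cite: MochizukiSemiAnbd2006, Cor 3.11 pp.45-47] -/
theorem vertexMap_actVertex_of_descends (γ : ΔX →* ΔY) (hN : ∀ n : ΔX, n ∈ TX.N i → γ n ∈ TY.N j)
    (hφγ : ∀ n : TX.N i, φ (TX.adm i n) = TY.adm j ⟨γ n, hN n n.2⟩) (g : ΔX)
    (v : (TX.Gc i).graph.Vertex) :
    F.base.vertexMap (TX.actVertex hP0X i hivX (g : ΓX) v) =
      TY.actVertex hP0Y j hivY ((γ g : ΔY) : ΓY) (F.base.vertexMap v) := by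
  -- `γ|_{N_i}` as a homomorphism of the levels
  let γN : TX.N i →* TY.N j :=
    { toFun := fun n => ⟨γ n, hN n n.2⟩
      map_one' := Subtype.ext (by simp)
      map_mul' := fun n m => Subtype.ext (by simp) }
  refine TX.vertexMap_actVertex_of_intertwines TY hP0X hP0Y hivX hivY F hFo φ hφ
    (TX.autOfConj_intertwines_of_descends TY hP0X hP0Y φ γN hφγ (fun n => ?_)) v
  -- conjugation by `g` on `N^X_i` goes to conjugation by `γ g` on `N^Y_j`
  apply Subtype.ext; apply Subtype.ext
  have h1 : ((TX.conjN i (g : ΓX) n : TX.N i) : ΔX) = g * (n : ΔX) * g⁻¹ :=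
    Subtype.ext (by simp [SpecialFibreTower.conjN])
  have h2 : ((TY.conjN j ((γ g : ΔY) : ΓY) (γN n) : TY.N j) : ΔY) = γ g * γ (n : ΔX) * (γ g)⁻¹ :=
    Subtype.ext (by simp [SpecialFibreTower.conjN, γN])
  change (((γN (TX.conjN i (g : ΓX) n) : TY.N j) : ΔY) : ΓY) = _
  rw [h2]
  change ((γ ((TX.conjN i (g : ΓX) n : TX.N i) : ΔX) : ΔY) : ΓY) = _
  rw [h1, map_mul, map_mul, map_inv]

end SpecialFibreTower

end Literature.AnabelianGeometry.SemiGraphs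

end
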